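import Summits.Ventures.QEC.Thresholds.PhenomenologicalBoxThresholds
import Literature.InformationTheory.QuantumCodes.TwistedToricErasureHalf
import Literature.InformationTheory.QuantumCodes.MatchingDecodersBoundary
import Literature.InformationTheory.QuantumCodes.CSSPhenomenologicalDepolarizing
import HarnessLib

/-!
# Certified thresholds for EVERY twisted / rotated toric code family (Kitaev's code on `ℝ²/Λ`, finite abelian `G`):
# code capacity `p₀(3) > .0285`, phenomenological `p₀(5) > .0101`, three-rate `p ≤ .0151`, `q ≤ .0101` — minimum-weight AND
# boundary-MWPM decoder families — UNCONDITIONAL, kernel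

Venture QEC, `Summits/Ventures/QEC/Thresholds/` (LADDER-QEC rung Q5 «families beyond the square torus», PARTITION row 09; qec-type-09 gen 5;
the census HB rows HB40 / HB90a / HB104 are twisted tori, 08.TWIST). qec-type-08's twisted toric code `TwistedToric.code g₁ g₂` (the
abelian two-block code `LP[1 + x^{g₁}, 1 + x^{g₂}]` of a finite abelian group: qubits `G ⊕ G`, stars `H_X`, plaquettes `H_Z`; `d = sys₁(Λ)`
when `g₁, g₂` generate, `TwistedToricDistance.lean`; loss threshold EXACTLY `1/2`, qec-type-03 `TwistedToricErasureHalf.lean`) has checks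
of weight `≤ 4` (`twistedToric_card_rowSupp_HX_le` / `_HZ_le`) meeting each qubit at most twice (`twistedToric_card_colSupp_HX_le` /
`_HZ_le`: graphlike with boundary), and every `Z`-logical has weight `≥ sys₁(Λ)` (`systole_le_hammingNorm_of_zLogical`). Hence the generic
Dumer–Kovalev–Pryadko rows of `CSSFamilyThresholds.lean` / `PhenomenologicalBoxThresholds.lean` and the three-rate law of
`CSSPhenomenologicalDepolarizing.lean` apply to every FAMILY `(G_i; g₁ⁱ, g₂ⁱ)` whose systole grows fast enough that `|G_i| r^{sys_i} → 0` for
all `r < 1` (e.g. `sys_i ≥ c log|G_i|` with `c` large, or the rotated families `sys ~ √|G|`), for EVERY minimum-weight (space-time)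
decoder family and — by Korte–Vygen Thm 12.9 with a boundary vertex (`isMinWeight_boundaryDecoder(_st)`) — for every boundary-MWPM family:

| theorem | statement |
|---|---|
| `twistedToric_z_isThresholdLowerBound`, `twistedToric_z_accuracyThreshold_gt_0285` | `Z` sector, code capacity: `≥ p₀(3)`, **`p_c > .0285`** (min-weight families) |
| `twistedToric_x_isThresholdLowerBound` | `X` sector (generation hypothesis): `≥ p₀(3)` |
| `twistedToric_z_mwpm_isThresholdLowerBound` | boundary-MWPM families: `≥ p₀(3)` |
| `twistedToric_z_phenom_isThresholdBoxLowerBound`, `twistedToric_x_phenom_isThresholdBoxLowerBound` | `T i` noisy rounds: two-rate boxes `p₀(5)` (`> .0101`) both records |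
| `twistedToric_depolPhenom_belowThreshold_0151_0101` | three-rate phenomenological depolarizing, sector-wise min-weight space-time decoding: `p ≤ .0151`, `q_X, q_Z ≤ .0101` ⇒ `P_fail → 0` |

HONEST FRAMING: the constants are the cluster-expansion ones (`w = 4`); the square torus has the sharper SAW constants `.0357 / .0112`
(`ToricCodeThresholdKernelSymmK16.lean` etc.), not claimed here for general twisted tori. All UNCONDITIONAL, tier CERTIFIED (kernel),
axioms standard, 0 named facts. Theorem-only file.

## References

* [KovalevPryadko2013Hyperbicycle] A. A. Kovalev, L. P. Pryadko, PRA 88 (2013) 012311, §III.B Ex. 2 (rotated toric codes).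
* [DennisEtAl2002] E. Dennis, A. Kitaev, A. Landahl, J. Preskill, J. Math. Phys. 43 (2002) 4452, §3.1–3.2, §4.4 p. 18, §5.3.
* [DumerKovalevPryadko2015] I. Dumer, A. A. Kovalev, L. P. Pryadko, PRL 115 (2015) 050502, Thms 2–3 with p. 5.
* [KorteVygen2002] B. Korte, J. Vygen, *Combinatorial Optimization* (2002), §12.2 Thm 12.9.
* [AliferisGottesmanPreskill2006] P. Aliferis, D. Gottesman, J. Preskill, arXiv:quant-ph/0504218, §8.2 (chunk p0026 L11: depolarizing).
-/

noncomputable section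

namespace Summit.Ventures.QEC.Thresholds

open Filter Topology Finset Matrix
open Literature.InformationTheory.QuantumCodes
open Literature.InformationTheory.QuantumCodes.TwistedToric

/-! ### Check weights and column weights of a twisted toric code -/

section Weights

variable {G : Type*} [AddCommGroup G] [DecidableEq G] [Fintype G]

/-- **Stars have weight `≤ 4`**: row `i` of `H_X` is supported on `{inl i, inl (i - g₁), inr i, inr (i - g₂)}`.
[cite: DennisEtAl2002, §3.1 (X_s = product of the four X's on the links meeting s)] -/
theorem twistedToric_card_rowSupp_HX_le (g₁ g₂ i : G) : (rowSupp (code g₁ g₂).HX i).card ≤ 4 := by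
  have hsub : rowSupp (code g₁ g₂).HX i ⊆ {Sum.inl i, Sum.inl (i - g₁), Sum.inr i, Sum.inr (i - g₂)} := by
    intro q hq
    simp only [rowSupp, mem_filter, mem_univ, true_and] at hq
    simp only [mem_insert, mem_singleton]
    rcases q with j | j
    · rw [code_HX_inl] at hq
      by_cases h1 : j = i
      · exact Or.inl (by rw [h1])
      · by_cases h2 : j = i - g₁
        · exact Or.inr (Or.inl (by rw [h2]))
        · simp [h1, h2] at hq
    · rw [code_HX_inr] at hq
      by_cases h1 : j = i
      · exact Or.inr (Or.inr (Or.inl (by rw [h1])))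
      · by_cases h2 : j = i - g₂
        · exact Or.inr (Or.inr (Or.inr (by rw [h2])))
        · simp [h1, h2] at hq
  exact (card_le_card hsub).trans (card_insert_le _ _ |>.trans (by
    refine Nat.succ_le_succ ((card_insert_le _ _).trans (Nat.succ_le_succ ((card_insert_le _ _).trans ?_)))
    simp))

/-- **Plaquettes have weight `≤ 4`**: row `i` of `H_Z` is supported on `{inl i, inl (i + g₂), inr i, inr (i + g₁)}`.
[cite: DennisEtAl2002, §3.1 (Z_P = product of the four Z's on the boundary of P)] -/
theorem twistedToric_card_rowSupp_HZ_le (g₁ g₂ i : G) : (rowSupp (code g₁ g₂).HZ i).card ≤ 4 := by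
  have hsub : rowSupp (code g₁ g₂).HZ i ⊆ {Sum.inl i, Sum.inl (i + g₂), Sum.inr i, Sum.inr (i + g₁)} := by
    intro q hq
    simp only [rowSupp, mem_filter, mem_univ, true_and] at hq
    simp only [mem_insert, mem_singleton]
    rcases q with j | j
    · rw [code_HZ_inl] at hq
      by_cases h1 : j = i
      · exact Or.inl (by rw [h1])
      · by_cases h2 : j = i + g₂
        · exact Or.inr (Or.inl (by rw [h2]))
        · simp [h1, h2] at hq
    · rw [code_HZ_inr] at hq
      by_cases h1 : j = i
      · exact Or.inr (Or.inr (Or.inl (by rw [h1])))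
      · by_cases h2 : j = i + g₁
        · exact Or.inr (Or.inr (Or.inr (by rw [h2])))
        · simp [h1, h2] at hq
  exact (card_le_card hsub).trans (card_insert_le _ _ |>.trans (by
    refine Nat.succ_le_succ ((card_insert_le _ _).trans (Nat.succ_le_succ ((card_insert_le _ _).trans ?_)))
    simp))

/-- **Each link lies in at most two stars**: the column of `H_X` at `inl j` is supported on `{j, j + g₁}`, at `inr j` on `{j, j + g₂}`
(graphlike with boundary). [cite: DennisEtAl2002, §3.2 (each link belongs to at most two sites)] -/
theorem twistedToric_card_colSupp_HX_le (g₁ g₂ : G) (q : G ⊕ G) : (colSupp (code g₁ g₂).HX q).card ≤ 2 := by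
  rcases q with j | j
  · have hsub : colSupp (code g₁ g₂).HX (Sum.inl j) ⊆ {j, j + g₁} := by
      intro i hi
      simp only [colSupp, mem_filter, mem_univ, true_and, code_HX_inl] at hi
      simp only [mem_insert, mem_singleton]
      by_cases h1 : j = i
      · exact Or.inl h1.symm
      · by_cases h2 : j = i - g₁
        · exact Or.inr (by rw [h2, sub_add_cancel])
        · simp [h1, h2] at hi
    exact (card_le_card hsub).trans (card_insert_le _ _ |>.trans (by simp))
  · have hsub : colSupp (code g₁ g₂).HX (Sum.inr j) ⊆ {j, j + g₂} := by
      intro i hi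
      simp only [colSupp, mem_filter, mem_univ, true_and, code_HX_inr] at hi
      simp only [mem_insert, mem_singleton]
      by_cases h1 : j = i
      · exact Or.inl h1.symm
      · by_cases h2 : j = i - g₂
        · exact Or.inr (by rw [h2, sub_add_cancel])
        · simp [h1, h2] at hi
    exact (card_le_card hsub).trans (card_insert_le _ _ |>.trans (by simp))

/-- **Each link lies in at most two plaquettes** (column weights of `H_Z` are `≤ 2`). [cite: DennisEtAl2002, §3.2 (each link belongs to at most two plaquettes)] -/
theorem twistedToric_card_colSupp_HZ_le (g₁ g₂ : G) (q : G ⊕ G) : (colSupp (code g₁ g₂).HZ q).card ≤ 2 := by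
  rcases q with j | j
  · have hsub : colSupp (code g₁ g₂).HZ (Sum.inl j) ⊆ {j, j - g₂} := by
      intro i hi
      simp only [colSupp, mem_filter, mem_univ, true_and, code_HZ_inl] at hi
      simp only [mem_insert, mem_singleton]
      by_cases h1 : j = i
      · exact Or.inl h1.symm
      · by_cases h2 : j = i + g₂
        · exact Or.inr (by rw [h2, add_sub_cancel_right])
        · simp [h1, h2] at hi
    exact (card_le_card hsub).trans (card_insert_le _ _ |>.trans (by simp))
  · have hsub : colSupp (code g₁ g₂).HZ (Sum.inr j) ⊆ {j, j - g₁} := by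
      intro i hi
      simp only [colSupp, mem_filter, mem_univ, true_and, code_HZ_inr] at hi
      simp only [mem_insert, mem_singleton]
      by_cases h1 : j = i
      · exact Or.inl h1.symm
      · by_cases h2 : j = i + g₁
        · exact Or.inr (by rw [h2, add_sub_cancel_right])
        · simp [h1, h2] at hi
    exact (card_le_card hsub).trans (card_insert_le _ _ |>.trans (by simp))

end Weights

/-! ### Families of twisted tori -/

section Family

variable {Gs : ℕ → Type*} [∀ i, AddCommGroup (Gs i)] [∀ i, DecidableEq (Gs i)] [∀ i, Fintype (Gs i)]

/-- **Code-capacity threshold `≥ p₀(3)` for every twisted toric code family, `Z` sector** (phase flips, star syndrome): for every family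
`(G_i; g₁ⁱ, g₂ⁱ)` with `2|G_i| r^{sys₁(Λ_i)} → 0` for all `0 < r < 1` and every minimum-weight decoder family. UNCONDITIONAL.
[cite: DumerKovalevPryadko2015, Thm 2 (y = 0, w = 4)] [cite: KovalevPryadko2013Hyperbicycle, §III.B Ex. 2] -/
theorem twistedToric_z_isThresholdLowerBound (g₁ g₂ : ∀ i, Gs i)
    (D : ∀ i, Decoder (Gs i → ZMod 2) (Gs i ⊕ Gs i → ZMod 2))
    (hD : ∀ i, (D i).IsMinWeight (code (g₁ i) (g₂ i)).zSyndrome ((code (g₁ i) (g₂ i)).kerX : Set _) hammingNorm)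
    (hgrowth : ∀ r : ℝ, 0 < r → r < 1 →
      Tendsto (fun i => (Fintype.card (Gs i ⊕ Gs i) : ℝ) * r ^ systole (g₁ i) (g₂ i)) atTop (𝓝 0)) :
    IsThresholdLowerBound (zFailureFamily (fun i => code (g₁ i) (g₂ i)) D) (thresholdValue 3) := by
  have h := z_isThresholdLowerBound_of_rowWeight (fun i => code (g₁ i) (g₂ i)) D hD (w := 4) (by norm_num)
    (fun i x => twistedToric_card_rowSupp_HX_le (g₁ i) (g₂ i) x) (fun i => systole (g₁ i) (g₂ i))
    (fun i => one_le_systole (g₁ i) (g₂ i)) (fun i x hx hxS => systole_le_hammingNorm_of_zLogical (g₁ i) (g₂ i) x hx hxS)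
    hgrowth
  norm_num at h
  exact h

/-- **`p_c^Z > .0285`** for every such twisted toric family and every minimum-weight decoder family — UNCONDITIONAL, kernel.
[cite: DumerKovalevPryadko2015, Thm 2] -/
theorem twistedToric_z_accuracyThreshold_gt_0285 (g₁ g₂ : ∀ i, Gs i)
    (D : ∀ i, Decoder (Gs i → ZMod 2) (Gs i ⊕ Gs i → ZMod 2))
    (hD : ∀ i, (D i).IsMinWeight (code (g₁ i) (g₂ i)).zSyndrome ((code (g₁ i) (g₂ i)).kerX : Set _) hammingNorm)
    (hgrowth : ∀ r : ℝ, 0 < r → r < 1 →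
      Tendsto (fun i => (Fintype.card (Gs i ⊕ Gs i) : ℝ) * r ^ systole (g₁ i) (g₂ i)) atTop (𝓝 0)) :
    (0.0285 : ℝ) < accuracyThreshold (zFailureFamily (fun i => code (g₁ i) (g₂ i)) D) :=
  lt_of_lt_of_le thresholdValue_three_bounds.1
    (le_accuracyThreshold (twistedToric_z_isThresholdLowerBound g₁ g₂ D hD hgrowth)
      ((thresholdValue_le_half _).trans (by norm_num)))

/-- **`X` sector, code capacity `≥ p₀(3)`** (bit flips, plaquette syndrome; `g₁ⁱ, g₂ⁱ` generate `G_i`, so `d^X = sys₁`), every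
minimum-weight decoder family. UNCONDITIONAL. [cite: DumerKovalevPryadko2015, Thm 2 (y = 0, w = 4)] -/
theorem twistedToric_x_isThresholdLowerBound (g₁ g₂ : ∀ i, Gs i)
    (hgen : ∀ i, AddSubgroup.closure ({g₁ i, g₂ i} : Set (Gs i)) = ⊤)
    (DX : ∀ i, Decoder (Gs i → ZMod 2) (Gs i ⊕ Gs i → ZMod 2))
    (hDX : ∀ i, (DX i).IsMinWeight (code (g₁ i) (g₂ i)).xSyndrome ((code (g₁ i) (g₂ i)).kerZ : Set _) hammingNorm)
    (hgrowth : ∀ r : ℝ, 0 < r → r < 1 →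
      Tendsto (fun i => (Fintype.card (Gs i ⊕ Gs i) : ℝ) * r ^ systole (g₁ i) (g₂ i)) atTop (𝓝 0)) :
    IsThresholdLowerBound (xFailureFamily (fun i => code (g₁ i) (g₂ i)) DX) (thresholdValue 3) := by
  have h := x_isThresholdLowerBound_of_rowWeight (fun i => code (g₁ i) (g₂ i)) DX hDX (w := 4) (by norm_num)
    (fun i x => twistedToric_card_rowSupp_HZ_le (g₁ i) (g₂ i) x) (fun i => systole (g₁ i) (g₂ i))
    (fun i => one_le_systole (g₁ i) (g₂ i))
    (fun i x hx hxS => by rw [← code_dX (hgen i)]; exact (code (g₁ i) (g₂ i)).dX_le_hammingNorm hx hxS)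
    hgrowth
  norm_num at h
  exact h

/-- **Boundary-MWPM families attain `p₀(3)`** (`Z` sector): the stars meet each link at most twice, so for every graphlike-with-boundary
presentation, every link metric and every matching decoder, `boundaryDecoder` is minimum-weight (Korte–Vygen Thm 12.9).
[cite: KorteVygen2002, §12.2 Thm 12.9] [cite: DennisEtAl2002, §4.4 p. 18] -/
theorem twistedToric_z_mwpm_isThresholdLowerBound (g₁ g₂ : ∀ i, Gs i)
    {ι : ∀ i, Gs i ⊕ Gs i → Sym2 (Option (Gs i))} (hι : ∀ i, IsGraphlikeVia (code (g₁ i) (g₂ i)).HX (ι i))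
    (m : ∀ i, EdgeMetric (ι i)) {D' : ∀ i, Decoder (Option (Gs i) → ZMod 2) (Gs i ⊕ Gs i → ZMod 2)}
    (hD : ∀ i, IsMatchingDecoder (m i) (D' i))
    (hgrowth : ∀ r : ℝ, 0 < r → r < 1 →
      Tendsto (fun i => (Fintype.card (Gs i ⊕ Gs i) : ℝ) * r ^ systole (g₁ i) (g₂ i)) atTop (𝓝 0)) :
    IsThresholdLowerBound (zFailureFamily (fun i => code (g₁ i) (g₂ i)) fun i => boundaryDecoder (D' i)) (thresholdValue 3) :=
  twistedToric_z_isThresholdLowerBound g₁ g₂ _ (fun i => isMinWeight_boundaryDecoder (hι i) (hD i)) hgrowth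

/-- Graphlike-with-boundary presentations of the stars exist for every twisted torus (column weights `≤ 2`).
[cite: DennisEtAl2002, §3.2] -/
theorem twistedToric_exists_isGraphlikeVia (g₁ g₂ : ∀ i, Gs i) :
    ∃ ι : ∀ i, Gs i ⊕ Gs i → Sym2 (Option (Gs i)), ∀ i, IsGraphlikeVia (code (g₁ i) (g₂ i)).HX (ι i) := by
  choose ι hι using fun i =>
    exists_isGraphlikeVia_of_card_colSupp_le_two (code (g₁ i) (g₂ i)).HX (twistedToric_card_colSupp_HX_le (g₁ i) (g₂ i))
  exact ⟨ι, hι⟩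

/-- **Two-rate phenomenological box `p₀(5)`, `Z` sector** (noisy star record, schedule `T i` with `3|G_i|T_i r^{sys_i} → 0`), every
minimum-weight space-time decoder family. UNCONDITIONAL. [cite: DumerKovalevPryadko2015, Thm 3 with p. 5 (w → w + 2, w = 4)] -/
theorem twistedToric_z_phenom_isThresholdBoxLowerBound (g₁ g₂ : ∀ i, Gs i) (T : ℕ → ℕ)
    (D : ∀ i, CSSPhenom.STDecoder (Gs i) (Gs i ⊕ Gs i) (T i))
    (hD : ∀ i, (D i).IsMinWeight (CSSPhenom.stSyn (code (g₁ i) (g₂ i)).HX (T i))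
      (CSSPhenom.stCycles (code (g₁ i) (g₂ i)).HX (T i)) hammingNorm)
    (hgrowth : ∀ r : ℝ, 0 < r → r < 1 →
      Tendsto (fun i => (((Fintype.card (Gs i ⊕ Gs i) + Fintype.card (Gs i)) * T i : ℕ) : ℝ) *
        r ^ systole (g₁ i) (g₂ i)) atTop (𝓝 0)) :
    IsThresholdBoxLowerBound (zPhenomFailureFamily₂ (fun i => code (g₁ i) (g₂ i)) T D) (thresholdValue 5) := by
  have h := z_phenom_isThresholdBoxLowerBound_of_rowWeight (fun i => code (g₁ i) (g₂ i)) T D hD (w := 4)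
    (fun i x => twistedToric_card_rowSupp_HX_le (g₁ i) (g₂ i) x) (fun i => systole (g₁ i) (g₂ i))
    (fun i => one_le_systole (g₁ i) (g₂ i)) (fun i x hx hxS => systole_le_hammingNorm_of_zLogical (g₁ i) (g₂ i) x hx hxS)
    hgrowth
  norm_num at h
  exact h

/-- **Two-rate phenomenological box `p₀(5)`, `X` sector** (noisy plaquette record; generation hypothesis), every minimum-weight
space-time decoder family. UNCONDITIONAL. [cite: DumerKovalevPryadko2015, Thm 3 with p. 5 (w = 4)] -/
theorem twistedToric_x_phenom_isThresholdBoxLowerBound (g₁ g₂ : ∀ i, Gs i)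
    (hgen : ∀ i, AddSubgroup.closure ({g₁ i, g₂ i} : Set (Gs i)) = ⊤) (T : ℕ → ℕ)
    (DX : ∀ i, CSSPhenom.STDecoder (Gs i) (Gs i ⊕ Gs i) (T i))
    (hDX : ∀ i, (DX i).IsMinWeight (CSSPhenom.stSyn (code (g₁ i) (g₂ i)).HZ (T i))
      (CSSPhenom.stCycles (code (g₁ i) (g₂ i)).HZ (T i)) hammingNorm)
    (hgrowth : ∀ r : ℝ, 0 < r → r < 1 →
      Tendsto (fun i => (((Fintype.card (Gs i ⊕ Gs i) + Fintype.card (Gs i)) * T i : ℕ) : ℝ) *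
        r ^ systole (g₁ i) (g₂ i)) atTop (𝓝 0)) :
    IsThresholdBoxLowerBound (xPhenomFailureFamily₂ (fun i => code (g₁ i) (g₂ i)) T DX) (thresholdValue 5) := by
  have h := x_phenom_isThresholdBoxLowerBound_of_rowWeight (fun i => code (g₁ i) (g₂ i)) T DX hDX (w := 4)
    (fun i x => twistedToric_card_rowSupp_HZ_le (g₁ i) (g₂ i) x) (fun i => systole (g₁ i) (g₂ i))
    (fun i => one_le_systole (g₁ i) (g₂ i))
    (fun i x hx hxS => by rw [← code_dX (hgen i)]; exact (code (g₁ i) (g₂ i)).dX_le_hammingNorm hx hxS)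
    hgrowth
  norm_num at h
  exact h

/-- **Three-rate phenomenological depolarizing noise, sector-wise minimum-weight space-time decoding of a twisted toric family**
(generation hypothesis; `3|G_i|T_i r^{sys_i} → 0`): `p ≤ .0151`, `q_X, q_Z ≤ .0101` ⇒ `P_fail → 0`. UNCONDITIONAL, kernel.
[cite: DumerKovalevPryadko2015, Thm 3 with p. 5 and eq. (succesful-decoding-depolarizing)] [cite: AliferisGottesmanPreskill2006, §8.2 (chunk p0026 L11)] -/
theorem twistedToric_depolPhenom_belowThreshold_0151_0101 (g₁ g₂ : ∀ i, Gs i)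
    (hgen : ∀ i, AddSubgroup.closure ({g₁ i, g₂ i} : Set (Gs i)) = ⊤) (T : ℕ → ℕ)
    (DZ DX : ∀ i, CSSPhenom.STDecoder (Gs i) (Gs i ⊕ Gs i) (T i))
    (hDZ : ∀ i, (DZ i).IsMinWeight (CSSPhenom.stSyn (code (g₁ i) (g₂ i)).HX (T i))
      (CSSPhenom.stCycles (code (g₁ i) (g₂ i)).HX (T i)) hammingNorm)
    (hDX : ∀ i, (DX i).IsMinWeight (CSSPhenom.stSyn (code (g₁ i) (g₂ i)).HZ (T i))
      (CSSPhenom.stCycles (code (g₁ i) (g₂ i)).HZ (T i)) hammingNorm)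
    (hgrowth : ∀ r : ℝ, 0 < r → r < 1 →
      Tendsto (fun i => (((Fintype.card (Gs i ⊕ Gs i) + Fintype.card (Gs i)) * T i : ℕ) : ℝ) *
        r ^ systole (g₁ i) (g₂ i)) atTop (𝓝 0))
    {p qX qZ : ℝ} (hp0 : 0 ≤ p) (hp : p ≤ 0.0151) (hqX0 : 0 ≤ qX) (hqX : qX ≤ 0.0101) (hqZ0 : 0 ≤ qZ) (hqZ : qZ ≤ 0.0101) :
    Tendsto (fun i => (code (g₁ i) (g₂ i)).depolPhenomFailureProb (T i) (DZ i) (DX i) p qX qZ) atTop (𝓝 0) := by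
  have h5 := thresholdValue_five_bounds.1
  have hv : thresholdValue (5 : ℝ) ≤ 1 / 2 := thresholdValue_le_half _
  exact CSSCode.depolPhenom_belowThreshold_of_box (fun i => code (g₁ i) (g₂ i)) T DZ DX
    (twistedToric_z_phenom_isThresholdBoxLowerBound g₁ g₂ T DZ hDZ hgrowth)
    (twistedToric_x_phenom_isThresholdBoxLowerBound g₁ g₂ hgen T DX hDX hgrowth)
    hp0 (by linarith) (by linarith) hqX0 (by linarith) (by linarith) hqZ0 (by linarith) (by linarith)

end Family

end Summit.Ventures.QEC.Thresholds

end
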